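import Summits.HodgeConjecture.CorCM.GaloisIndexTwoProductForms
import HarnessLib

/-!
# `Γ₀ × C₂ × C₂` is BAD for EVERY `Γ₀` with an abelian index-two subgroup `A₀ ∋ c`, `|A₀| ≥ 4` — the factor `C₂²` is never exceptional

COR-CM (cell `pub-hodgecm2`), binder seat b04 (gen 30), count-neutral own lane «Galois-CM-type classification» (which Galois CM
fields `(G, c)` have ALL primitive CM types nondegenerate = GOOD, vs. a primitive degenerate type = BAD).  KERNEL ONLY: theorems;
no definition, no named fact, no `sorry`.  `HC_CM` is neither used nor claimed.

Gen 24's real-factor theorem leaves `H ∈ {C₂, C₂², C₂³, C₄, C_p, S₃}` as the totally real Galois factors that may fail to make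
`Γ × H` BAD; gen 23 settled `Q_{4n} × C₂²` by a special fibre pattern.  The `× C₂` theorem of this generation
(`CorCM/GaloisIndexTwoTimesTwo`, product form `CorCM/GaloisIndexTwoProductForms.exists_simple_degenerate_prod_two`) applied to
`Γ₀' = Γ₀ × C₂` with `A₀' = A₀ × C₂` — which is NEVER a cyclic `2`-group, has `|A₀'| = 2|A₀| > 4` as soon as `|A₀| > 2`, and contains
`u = (1, t)` with `c ∉ ⟨u⟩` — gives at once:

THEOREM (**`exists_simple_degenerate_prod_kleinFour`**).  `K` Galois CM, `e : Gal(K/ℚ) ≃* Γ₀ × (C₂ × C₂)`, `i₀ : A₀ ↪ Γ₀` abelian of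
index two (`Γ₀ = i₀(A₀) ⊔ i₀(A₀)x₀`, `x₀ i₀(a) = i₀(θ₀ a) x₀`, `x₀² = i₀(q₀)` for ANY `q₀` — easy or hard side), complex conjugation
`(i₀ c, 1)`, `|A₀| > 2` ⟹ `K` carries a SIMPLE DEGENERATE abelian variety of dimension `2|Γ₀|` with CM by `K` (rational `(p,p)`
class outside the divisor ring on some power).  So **`C₂²` (hence `C₂³`, …) is NOT an exceptional real factor for any group with an
abelian subgroup of index two containing `c`** — dicyclic, dihedral, semidihedral, modular, `C_p ⋊ C_{2^k}`, abelian non-`C₂`-by-…: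
e.g. `Q₈ × C₂²`, `Q₁₆ × C₂²`, `D₄ × C₂²` (order-32 census rows), `(C_p ⋊ C₈) × C₂²`, `Dic_m × C₂²` (gen 23), `C₈ × C₂²` (gen 15/16's
abelian atoms), uniformly.

## References

* [Kubota1965] T. Kubota, *On the field extension by complex multiplication*, Trans. AMS 118 (1965), §2, §4 Lemma 2.
* [Shimura1998] G. Shimura, *Abelian Varieties with Complex Multiplication and Modular Functions*, §6.2 Thm. 3, §8.2 Prop. 26.
* [Gordon1999HodgeAVSurvey] B. B. Gordon, *A survey of the Hodge conjecture for abelian varieties*, Thm. 6.4, §9.3.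
-/

noncomputable section

open CategoryTheory CategoryTheory.Limits NumberField
open scoped BigOperators

namespace Summit.HodgeConjecture.CorCM.SplitInvolution

open Literature.NumberTheory.ComplexMultiplication
open Literature.AlgebraicGeometry.Motives (AbelianVariety CMType)
open Literature.AlgebraicGeometry.HodgeTheory
open Literature.AlgebraicGeometry.ComplexMultiplication (IsCMTypeRealisation)
open Literature.AlgebraicGeometry.Pohlmann1968
open Literature.Barriers.HodgeConjecture (divisorClassesSpan)
open Summit.HodgeConjecture.CorCM.GaloisRank (model_complexConj_ne_one)

section Field

variable {Γ₀ : Type*} [Group Γ₀] [Fintype Γ₀] [DecidableEq Γ₀]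
variable {A₀ : Type*} [CommGroup A₀] [Fintype A₀] [DecidableEq A₀]
variable {K : Type} [Field K] [NumberField K] [IsCMField K] [IsGalois ℚ K]

/-- **`Γ₀ × C₂ × C₂` IS ALWAYS BAD** (`Γ₀ ⊇ i₀(A₀)` abelian of index two, `c ∈ A₀`, `|A₀| > 2`, ANY `q₀`): `e : Gal(K/ℚ) ≃* Γ₀ × (C₂ × C₂)`
with complex conjugation `(i₀ c, 1)` ⟹ a SIMPLE DEGENERATE abelian variety of dimension `2|Γ₀|` with CM by `K` (rational `(p,p)` class
outside the divisor ring on some power). [cite: Kubota1965, §2 and §4 Lemma 2] [cite: Shimura1998, §6.2 Thm. 3 and §8.2 Prop. 26]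
[cite: Gordon1999HodgeAVSurvey, Thm. 6.4 and §9.3] -/
theorem exists_simple_degenerate_prod_kleinFour
    (e : (K ≃ₐ[ℚ] K) ≃* Γ₀ × (Multiplicative (ZMod 2) × Multiplicative (ZMod 2))) (i₀ : A₀ →* Γ₀)
    (hi₀ : Function.Injective i₀) (x₀ : Γ₀) (hx₀ : ∀ a, i₀ a ≠ x₀)
    (hcov₀ : ∀ g : Γ₀, (∃ a, g = i₀ a) ∨ (∃ a, g = i₀ a * x₀)) (θ₀ : A₀ ≃* A₀) (hθ₀ : ∀ a, x₀ * i₀ a = i₀ (θ₀ a) * x₀)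
    (q₀ : A₀) (hq₀ : x₀ * x₀ = i₀ q₀) (c : A₀) (hc : e ((IsCMField.complexConj K).restrictScalars ℚ) = (i₀ c, 1))
    (hcard : 2 < Fintype.card A₀) :
    ∃ (Φ : CMType K) (φ₀ : K →+* ℂ) (X : AbelianVariety ℂ) (ι : 𝓞 K →+* End X)
      (ϑ : K →+* Module.End ℂ (complexBetti X.X 1)),
      IsPrimitive (ℂ ≃+* ℂ) Φ.1 φ₀ ∧ ¬ IsNondegenerate Φ ∧ IsCMTypeRealisation Φ X ι ϑ ∧ X.IsSimple ∧
      X.dim = 2 * Fintype.card Γ₀ ∧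
      ∃ n p : ℕ, ∃ y : complexBetti (⨁ fun _ : Fin n => X).X (2 * p), IsRationalClass y ∧
        IsOfHodgeType (⨁ fun _ : Fin n => X).dim (⨁ fun _ : Fin n => X).X (2 * p) p p y ∧
        y ∉ divisorClassesSpan (⨁ fun _ : Fin n => X).X (⨁ fun _ : Fin n => X).dim p := by
  classical
  -- regroup `Γ₀ × (C₂ × C₂)` as `(Γ₀ × C₂) × C₂`
  let e' : (K ≃ₐ[ℚ] K) ≃* (Γ₀ × Multiplicative (ZMod 2)) × Multiplicative (ZMod 2) := e.trans MulEquiv.prodAssoc.symm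
  have hc1 : c ≠ 1 := by
    rintro rfl
    exact model_complexConj_ne_one e hc (by rw [map_one]; rfl)
  -- index-two data for `Γ₀' = Γ₀ × C₂` with `A₀' = A₀ × C₂`
  let i₁ : A₀ × Multiplicative (ZMod 2) →* Γ₀ × Multiplicative (ZMod 2) := MonoidHom.prodMap i₀ (MonoidHom.id _)
  have hi₁_apply : ∀ a v, i₁ (a, v) = (i₀ a, v) := fun a v => rfl
  have hi₁ : Function.Injective i₁ := by
    rintro ⟨a, v⟩ ⟨a', v'⟩ h
    rw [hi₁_apply, hi₁_apply, Prod.mk.injEq] at h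
    exact Prod.ext (hi₀ h.1) h.2
  have hx₁ : ∀ w, i₁ w ≠ (x₀, 1) := fun ⟨a, v⟩ h => hx₀ a (by rw [hi₁_apply, Prod.mk.injEq] at h; exact h.1)
  have hcov₁ : ∀ g : Γ₀ × Multiplicative (ZMod 2), (∃ w, g = i₁ w) ∨ (∃ w, g = i₁ w * (x₀, 1)) := by
    rintro ⟨g, v⟩
    rcases hcov₀ g with ⟨a, rfl⟩ | ⟨a, rfl⟩
    · exact Or.inl ⟨(a, v), rfl⟩
    · exact Or.inr ⟨(a, v), by rw [hi₁_apply, Prod.mk_mul_mk, mul_one]⟩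
  let θ₁ : A₀ × Multiplicative (ZMod 2) ≃* A₀ × Multiplicative (ZMod 2) := MulEquiv.prodCongr θ₀ (MulEquiv.refl _)
  have hθ₁ : ∀ w, (x₀, (1 : Multiplicative (ZMod 2))) * i₁ w = i₁ (θ₁ w) * (x₀, 1) := fun ⟨a, v⟩ => by
    change (x₀, (1 : Multiplicative (ZMod 2))) * i₁ (a, v) = i₁ (θ₀ a, v) * (x₀, 1)
    rw [hi₁_apply, hi₁_apply, Prod.mk_mul_mk, Prod.mk_mul_mk, one_mul, mul_one, hθ₀]
  have hq₁ : (x₀, (1 : Multiplicative (ZMod 2))) * (x₀, 1) = i₁ (q₀, 1) := by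
    rw [hi₁_apply, Prod.mk_mul_mk, mul_one, hq₀]
  have hc' : e' ((IsCMField.complexConj K).restrictScalars ℚ) = (i₁ (c, 1), 1) := by
    change MulEquiv.prodAssoc.symm (e ((IsCMField.complexConj K).restrictScalars ℚ)) = _
    rw [hc]
    rfl
  -- `u = (1, t)`: `c' = (c, 1) ∉ ⟨u⟩`, `|A₀ × C₂| > 4`
  have hu : ((1, Multiplicative.ofAdd 1) : A₀ × Multiplicative (ZMod 2)) ≠ 1 := by
    rw [Ne, Prod.mk_eq_one, not_and_or]
    exact Or.inr (by decide)
  have hcu : ((c, 1) : A₀ × Multiplicative (ZMod 2)) ∉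
      Subgroup.zpowers ((1, Multiplicative.ofAdd 1) : A₀ × Multiplicative (ZMod 2)) := by
    rw [Subgroup.mem_zpowers_iff]
    rintro ⟨k, hk⟩
    rw [Prod.pow_mk, one_zpow, Prod.mk.injEq] at hk
    exact hc1 hk.1.symm
  have hcard' : 4 < Fintype.card (A₀ × Multiplicative (ZMod 2)) := by
    rw [Fintype.card_prod, Fintype.card_multiplicative, ZMod.card]; omega
  obtain ⟨Φ, φ₀, X, ι, ϑ, h1, h2, h3, h4, h5, h6⟩ := exists_simple_degenerate_prod_two e' i₁ hi₁ (x₀, 1) hx₁ hcov₁ θ₁ hθ₁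
    (q₀, 1) hq₁ (c, 1) hc' (1, Multiplicative.ofAdd 1) hu hcu hcard'
  refine ⟨Φ, φ₀, X, ι, ϑ, h1, h2, h3, h4, ?_, h6⟩
  rw [h5, Fintype.card_prod, Fintype.card_multiplicative, ZMod.card, mul_comm]

end Field

end Summit.HodgeConjecture.CorCM.SplitInvolution

end
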